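import Mathlib
import Literature.AlgebraicGeometry.Resolution.Lipman1969RationalSurfaceSingularities
import Literature.AlgebraicGeometry.Resolution.AdicCompletionRegular
import Literature.AlgebraicGeometry.Resolution.ProjectiveSpaceRegular
import HarnessLib

/-!
# Route `HomologicalConductor`, crux `NoZenoR` (stmt-ResolutionOfSingularities-19943): the exceptional-curve count
# `N(R) ≤ N` — vocabulary (W4.4 object U7)

`[OURS · L W4.4]` Cell res-hironaka, crux chain W4.4 (res-L0-w44-plan-1 RULINGS (ρ13b), 2026-08-27).  ONE definition in the
style of U5 (`…SurfaceTerminationGenusDefs`, `HasGeometricGenusLE`): the number of integral exceptional curves of the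
MINIMAL resolution is at most `N`.  It is the descent measure of res-L0-w44-idea-2's card thread-nash, lemma (L1)
«X¹-SANDWICH» (the count `N` drops while the index does not), and of res-L0-w44-tri-2's K44CYL table; every typed form of
(L1) needs this predicate.  Nothing here is a statement of the manuscript under review (Hironaka 2017); OURS; AI-written,
weaker than expert review.

* `HasExcCurveCountLE R N` — «`N(R) ≤ N`»: SOME minimal resolution `π : X → Spec R` (`IsMinimalResolution`, tree
  `Resolution/ReflexiveModulesRationalDoublePoints`) has finitely many integral exceptional curves (`excCurvePoints π`, tree
  `Resolution/Lipman1969RationalSurfaceSingularities`: the points `η` over the closed point with `Order.height η = 1` in the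
  specialisation order) and at most `N` of them (`Set.ncard`).
* `hasExcCurveCountLE_iff` (`Iff.rfl`), `hasExcCurveCountLE_mono` (monotone in `N`),
  `hasExcCurveCountLE_zero_of_isRegularLocalRing` (a regular local ring has `N(R) ≤ 0`: the identity of `Spec R` is a minimal
  resolution (`isMinimalResolution_id`, `Spec R` regular by `isRegularRing_of_isRegularLocalRing` + `Scheme.isRegular_Spec`) and it
  has NO exceptional curve, the closed point having height `0` in the specialisation order).

References: J. Lipman, *Rational singularities…*, Publ. IHÉS 36 (1969), §12 (p. 220) [`Lipman1969`]; L. Bădescu, *Algebraic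
Surfaces* (2001), Def. 4.4 / Prop. 4.5 [`Badescu2001`].
-/

-- single-problem summit: the doubled namespace component `ResolutionOfSingularities` is forced
set_option linter.dupNamespace false

noncomputable section

open CategoryTheory AlgebraicGeometry IsLocalRing
open Literature.AlgebraicGeometry.Resolution

namespace Summit.ResolutionOfSingularities.ResolutionOfSingularities.Theorems.NoZeno.ExcCount

/-- **`N(R) ≤ N`**: some minimal resolution `π : X → Spec R` (`IsMinimalResolution`: a resolution through which every
resolution factors) has finitely many integral exceptional curves — generic points `η` of one-dimensional integral closed
subschemes of `X` lying over the closed point of `R` (`excCurvePoints π`) — and at most `N` of them.  The descent measure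
of res-L0-w44-idea-2's card thread-nash (L1) X¹-SANDWICH lemma and of res-L0-w44-tri-2's K44CYL-TABLE («`N` drops, the index does
not»).  OURS. [this work] -/
def HasExcCurveCountLE (R : Type) [CommRing R] [IsLocalRing R] (N : ℕ) : Prop :=
  ∃ (X : Scheme.{0}) (π : X ⟶ Spec (.of R)),
    IsMinimalResolution π ∧ (excCurvePoints π).Finite ∧ (excCurvePoints π).ncard ≤ N

/-- Unfolding of `HasExcCurveCountLE` (`Iff.rfl`). [folklore] -/
theorem hasExcCurveCountLE_iff (R : Type) [CommRing R] [IsLocalRing R] (N : ℕ) :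
    HasExcCurveCountLE R N ↔
      ∃ (X : Scheme.{0}) (π : X ⟶ Spec (.of R)),
        IsMinimalResolution π ∧ (excCurvePoints π).Finite ∧ (excCurvePoints π).ncard ≤ N :=
  Iff.rfl

/-- **Monotonicity in `N`.** [this work] -/
theorem hasExcCurveCountLE_mono {R : Type} [CommRing R] [IsLocalRing R] {N N' : ℕ} (h : N ≤ N') :
    HasExcCurveCountLE R N → HasExcCurveCountLE R N' := by
  rintro ⟨X, π, hπ, hfin, hN⟩
  exact ⟨X, π, hπ, hfin, hN.trans h⟩

/-- A point of a scheme to which every point specialises is the least element of the specialisation order of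
Mathlib's schemes (`x ≤ y ↔ y ⤳ x`), hence of `Order.height` zero. [folklore] -/
theorem height_eq_zero_of_forall_specializes {X : Scheme.{0}} (x : X) (h : ∀ y : X, y ⤳ x) :
    Order.height x = 0 := by
  rw [Order.height_eq_zero]
  exact fun b _ => h b

/-- The identity of `Spec R`, `R` local, has no integral exceptional curve: a point over the closed point IS the closed
point, to which every point specialises, so its height is `0 ≠ 1`. [cite: Lipman1969, Section 12 (p. 220)] -/
theorem excCurvePoints_id_eq_empty (R : Type) [CommRing R] [IsLocalRing R] :
    excCurvePoints (𝟙 (Spec (.of R))) = ∅ := by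
  ext η
  simp only [excCurvePoints, Set.mem_setOf_eq, Set.mem_empty_iff_false, iff_false, not_and]
  intro hη h1
  have hη' : η = closedPoint R := by simpa using hη
  have h0 : Order.height η = 0 := height_eq_zero_of_forall_specializes η fun y => by
    rw [hη']
    exact (PrimeSpectrum.le_iff_specializes (y : PrimeSpectrum R) (closedPoint R)).mp
      (IsLocalRing.le_maximalIdeal y.2.ne_top)
  rw [h0] at h1
  exact zero_ne_one h1

/-- **A regular local ring has `N(R) ≤ 0`**: `Spec R` is regular (`isRegularRing_of_isRegularLocalRing`, Serre's
localisation theorem, and `Scheme.isRegular_Spec`), so its identity is a minimal resolution (`isMinimalResolution_id`) with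
no exceptional curve (`excCurvePoints_id_eq_empty`). [this work] -/
theorem hasExcCurveCountLE_zero_of_isRegularLocalRing (R : Type) [CommRing R] [IsRegularLocalRing R] :
    HasExcCurveCountLE R 0 := by
  haveI := isRegularRing_of_isRegularLocalRing R
  refine ⟨Spec (.of R), 𝟙 _, isMinimalResolution_id (Scheme.isRegular_Spec (.of R)), ?_, ?_⟩
  · rw [excCurvePoints_id_eq_empty]; exact Set.finite_empty
  · rw [excCurvePoints_id_eq_empty, Set.ncard_empty]

end Summit.ResolutionOfSingularities.ResolutionOfSingularities.Theorems.NoZeno.ExcCount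

end
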